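import Summits.Ventures.CertifiedManyBodySolver.Observables.PairLROTowerCeilingCert
import HarnessLib

/-!
# Ventures/CertifiedManyBodySolver — Observables/RungLeavesPairLROTTPrimeOnePoint.lean

HONEST FRAMING: first certified bounds on pairing observables; not a superconductivity verdict; every number
certified (two lineages + referee) or labelled float. hubbard-obs cell (D-0042); hubbard-obs-p1 seat
(`prover-hubbard-obs-p1-g5-0`). Zero compute; no certificate; no definition; no `sorry`.

The two ORBIT-STATE-form dischargers of the `t′`-generic summit-format pair-LRO leaf `M3ObsPairLROCeilingAt tp c`
(RungLeavesPairLROTTPrime) — the shape in which the OP1-E claim nodes are typed (`Certificates/…obsOP1E…`: for every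
unit torus vector `ζ`, `c₀ − A + Σ_σ μ_σ(Re⟨ζ,N_σζ⟩/L² − ν) + κ(u − Re⟨ζ,H^{1,tp}_Lζ⟩/L²) ≤ Re ω̄_ζ(Γ(ι_{Λ'})(−Γ(incl)Φ₀))`,
`H^{1,tp}_L = hubbardTorusTT' L 1 tp 8`) — so that a node at ANY `t′` (the STEP-0 anchor A0 = `t′ = −1/4`) reads in
one application:
* `M3ObsPairLROCeilingAt_of_onePoint_orbitState_bound` — two-sector (KHvdL) constant: leaf at every
  `c ≥ 2(c₀ − A + (Σμ)(7/16 − ν))²`;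
* `M3ObsPairLROCeilingAt_of_onePoint_orbitState_bound_sq` — Koma–Tasaki tower constant: leaf at every
  `c ≥ (c₀ − A + (Σμ)(7/16 − ν))²`.
Point group `S ≠ ∅` with `b1gSign = 1` on `S`; window `Λ' ⊇ pairRegion {0,±e₁,±e₂} 0` fitting the tori of side `≥ L₁`;
cap node `M3EnergyUpperRow tp hi`, `hi ≤ u`, `κ ≥ 0`. CONDITIONAL ON THE CLAIM NODES fed in. A ceiling never speaks to presence.
References: T. Koma, H. Tasaki, J. Stat. Phys. 76 (1994) 745, Theorems 2.2 and 5 [KomaTasaki1994]; D. J. Scalapino,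
Phys. Rep. 250 (1995) 329, §2 eq. (2.4) [Scalapino1995].
-/

noncomputable section

namespace Summit.Ventures.CertifiedManyBodySolver.Observables

open Matrix Complex Finset Literature.MathematicalPhysics.QuantumLattice Literature.Probability.LatticeModels
open Literature.MathematicalPhysics.QuantumLattice.HubbardWave0 ThermodynamicLimit Filter Topology
open Literature.MathematicalPhysics.QuantumManyBody.StateRelaxation
open Summit.Ventures.CertifiedManyBodySolver.Transport
open scoped ComplexOrder ComplexConjugate BigOperators

/-- **Orbit-state one-point bound at hopping `t′` ⇒ the leaf at the two-sector constant `2M²`.**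
[cite: KomaTasaki1994, Theorem 2.2] -/
theorem M3ObsPairLROCeilingAt_of_onePoint_orbitState_bound {tp : ℝ} {hi c' : ℚ} {c A κ u ν : ℝ}
    (μ : Fin 2 → ℝ) (hκ : 0 ≤ κ) (hE : M3EnergyUpperRow tp hi) (hhi : ((hi : ℚ) : ℝ) ≤ u)
    {S : Finset (DihedralGroup 4)} (hS : S.Nonempty) (hS1 : ∀ γ ∈ S, b1gSign γ = 1)
    {Λ' : Finset (Site 2)} (h0 : pairRegion (insert (0 : Site 2) unitSteps) 0 ⊆ Λ') (L₁ : ℕ)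
    (hInj : ∀ L : ℕ, L₁ ≤ L → Set.InjOn (Torus.proj (d := 2) L) ↑Λ')
    (hbound : ∀ (L : ℕ) [NeZero L] (hL : L₁ ≤ L) (ζ : Fock (Orb (FermionTorus 2 L))), star ζ ⬝ᵥ ζ = 1 →
      c - A + ∑ σ : Fin 2, μ σ *
          ((star ζ ⬝ᵥ ((∑ y : FermionTorus 2 L, numberOp y σ) *ᵥ ζ)).re / (L : ℝ) ^ 2 - ν) +
        κ * (u - (star ζ ⬝ᵥ (hubbardTorusTT' L 1 tp 8 *ᵥ ζ)).re / (L : ℝ) ^ 2) ≤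
        (orbitState (spaceGroupUnitary S) ζ (fermionEmbed (PolySite.toTorusEmb L (hInj L hL))
          (-(fermionEmbed (PolySite.incl h0)
            (localPairAt (insert (0 : Site 2) unitSteps) dWaveFormFactor 0))))).re)
    (hc' : 2 * (c - A + (∑ σ : Fin 2, μ σ) * ((7 / 8 : ℝ) / 2 - ν)) ^ 2 ≤ ((c' : ℚ) : ℝ)) :
    M3ObsPairLROCeilingAt tp c' := by
  intro ψ hψ hψ1
  have hu : energyDensityTT' 1 tp 8 (7 / 8) ≤ u :=
    (show energyDensityTT' 1 tp 8 (7 / 8) ≤ ((hi : ℚ) : ℝ) from hE).trans hhi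
  have hg : ∀ γ ∈ S, ∀ e ∈ insert (0 : Site 2) unitSteps, dWaveFormFactor (d4Vec γ e) = dWaveFormFactor e :=
    fun γ hγ e _ => dWaveFormFactor_d4Vec_of_b1gSign_eq_one (hS1 γ hγ) e
  exact (liminf_pairFieldLRO_le_of_onePoint_orbitState_bound_TT' dWaveFormFactor 1 tp (by norm_num)
    (by norm_num) (by norm_num) μ hκ hu hS hg h0 L₁ hInj hbound ψ hψ hψ1).trans hc'

/-- **Orbit-state one-point bound at hopping `t′` ⇒ the leaf at the SHARP (tower) constant `M²`.**
[cite: KomaTasaki1994, Theorem 5] -/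
theorem M3ObsPairLROCeilingAt_of_onePoint_orbitState_bound_sq {tp : ℝ} {hi c' : ℚ} {c A κ u ν : ℝ}
    (μ : Fin 2 → ℝ) (hκ : 0 ≤ κ) (hE : M3EnergyUpperRow tp hi) (hhi : ((hi : ℚ) : ℝ) ≤ u)
    {S : Finset (DihedralGroup 4)} (hS : S.Nonempty) (hS1 : ∀ γ ∈ S, b1gSign γ = 1)
    {Λ' : Finset (Site 2)} (h0 : pairRegion (insert (0 : Site 2) unitSteps) 0 ⊆ Λ') (L₁ : ℕ)
    (hInj : ∀ L : ℕ, L₁ ≤ L → Set.InjOn (Torus.proj (d := 2) L) ↑Λ')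
    (hbound : ∀ (L : ℕ) [NeZero L] (hL : L₁ ≤ L) (ζ : Fock (Orb (FermionTorus 2 L))), star ζ ⬝ᵥ ζ = 1 →
      c - A + ∑ σ : Fin 2, μ σ *
          ((star ζ ⬝ᵥ ((∑ y : FermionTorus 2 L, numberOp y σ) *ᵥ ζ)).re / (L : ℝ) ^ 2 - ν) +
        κ * (u - (star ζ ⬝ᵥ (hubbardTorusTT' L 1 tp 8 *ᵥ ζ)).re / (L : ℝ) ^ 2) ≤
        (orbitState (spaceGroupUnitary S) ζ (fermionEmbed (PolySite.toTorusEmb L (hInj L hL))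
          (-(fermionEmbed (PolySite.incl h0)
            (localPairAt (insert (0 : Site 2) unitSteps) dWaveFormFactor 0))))).re)
    (hc' : (c - A + (∑ σ : Fin 2, μ σ) * ((7 / 8 : ℝ) / 2 - ν)) ^ 2 ≤ ((c' : ℚ) : ℝ)) :
    M3ObsPairLROCeilingAt tp c' := by
  intro ψ hψ hψ1
  have hu : energyDensityTT' 1 tp 8 (7 / 8) ≤ u :=
    (show energyDensityTT' 1 tp 8 (7 / 8) ≤ ((hi : ℚ) : ℝ) from hE).trans hhi
  have hg : ∀ γ ∈ S, ∀ e ∈ insert (0 : Site 2) unitSteps, dWaveFormFactor (d4Vec γ e) = dWaveFormFactor e :=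
    fun γ hγ e _ => dWaveFormFactor_d4Vec_of_b1gSign_eq_one (hS1 γ hγ) e
  exact (liminf_pairFieldLRO_le_sq_of_onePoint_orbitState_bound_TT' dWaveFormFactor 1 tp (by norm_num)
    (by norm_num) (by norm_num) μ hκ hu hS hg h0 L₁ hInj hbound ψ hψ hψ1).trans hc'

end Summit.Ventures.CertifiedManyBodySolver.Observables

end
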